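import Mathlib.Data.Matrix.Block
import Mathlib.LinearAlgebra.Matrix.MvPolynomial
import Mathlib.Logic.Equiv.Fin.Basic
import Literature.Computability.AlgebraicComplexity.ValiantClassesProofs
import Literature.Computability.AlgebraicComplexity.StandardFamilies
import Literature.LinearAlgebra.Matrix.PermanentSubperm
import HarnessLib

/-!
# The permanent family is monotone: `per_m` is a projection of `per_{m'}` for `m ≤ m'`

Topic `Computability/AlgebraicComplexity`. The standard padding of the permanent: for `m ≤ m'`,
`per_m(X) = per ( X 0 ; 0 I_{m'-m} )`, i.e. `per_m` is obtained from `per_{m'}` by substituting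
`X_{ij} ↦ X_{ij}` (`i, j < m`), `X_{ii} ↦ 1` (`i ≥ m`) and `X_{ij} ↦ 0` otherwise — a Valiant
PROJECTION (Bürgisser 2000, Def. 2.6; BCS 1997 (21.12)). Consequently the circuit complexity of
the permanent is monotone in the size: `L(per_m) ≤ L(per_{m'})` (projections are free,
`complexity_le_of_isProjection`, Bürgisser 2000 Rem. 2.7). This is the step "if `Perm_m` requires
size `2^{m^ε}` then so does `Perm_[p]`" of Kumar–Ramya–Saptharishi–Tengse 2022, §3.5 (`Perm_[p]` =
`Perm_m` on the first `m²` of `p` variables), and it is what makes the two spellings of the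
hypothesis "the permanent is `2^{m^ε}`-hard" — for ALL large `m`, or along a subsequence such as
`m = k^c` — interchangeable (referee note B13 of the cell `valiant-natproofs`: the transfer lemma
`two_pow_le_complexity_perPoly_of_le` below).

Proved here: `aeval_padSubst_perPoly` (the block identity), `isProjection_perPoly_of_le`,
`complexity_perPoly_mono`, `two_pow_le_complexity_perPoly_of_le`.

## References

* [KumarRamyaSaptharishiTengse2022] M. Kumar, C. Ramya, R. Saptharishi, A. Tengse, *If VNP is
  hard, then so are equations for it*, STACS 2022, §3.4–3.5 (`Perm_[p]`).
* [Burgisser2000] P. Bürgisser, *Completeness and Reduction in Algebraic Complexity Theory*,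
  Springer 2000, Def. 2.6 and Rem. 2.7 (projections).
-/

noncomputable section

namespace Literature.Computability.AlgebraicComplexity

open MvPolynomial Matrix

variable {k : Type*} [CommSemiring k]

/-- The permanent commutes with ring homomorphisms applied entrywise. [folklore] -/
private theorem permanent_map_ringHom' {n : Type*} [DecidableEq n] [Fintype n]
    {R S : Type*} [CommSemiring R] [CommSemiring S] (f : R →+* S) (M : Matrix n n R) :
    (M.map f).permanent = f M.permanent := by
  simp [Matrix.permanent, map_sum, map_prod]

section Pad

variable {m m' : ℕ}

/-- The index splitting `Fin m ⊕ Fin (m' - m) ≃ Fin m'` for `m ≤ m'`. [folklore] -/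
private def split (h : m ≤ m') : Fin m ⊕ Fin (m' - m) ≃ Fin m' :=
  finSumFinEquiv.trans (finCongr (Nat.add_sub_cancel' h))

variable (k)

/-- **The padding substitution** `X_{ij} ↦ (X 0; 0 I)_{ij}`: variables on the leading `m × m`
block, `1` on the trailing diagonal, `0` elsewhere. [cite: KumarRamyaSaptharishiTengse2022, §3.4] -/
def padSubst (h : m ≤ m') : Fin m' × Fin m' → MvPolynomial (Fin m × Fin m) k :=
  fun ij => match (split h).symm ij.1, (split h).symm ij.2 with
    | Sum.inl i, Sum.inl j => X (i, j)
    | Sum.inr i, Sum.inr j => if i = j then C 1 else C 0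
    | _, _ => C 0

/-- Every value of the padding substitution is a variable or a constant (it is a projection in
Valiant's sense). [cite: Burgisser2000, Def. 2.6] -/
theorem padSubst_isVarOrConst (h : m ≤ m') (ij : Fin m' × Fin m') :
    (∃ v, padSubst k h ij = X v) ∨ ∃ c, padSubst k h ij = C c := by
  unfold padSubst
  rcases (split h).symm ij.1 with i | i <;> rcases (split h).symm ij.2 with j | j
  · exact Or.inl ⟨(i, j), rfl⟩
  · exact Or.inr ⟨0, rfl⟩
  · exact Or.inr ⟨0, rfl⟩
  · by_cases hij : i = j
    · exact Or.inr ⟨1, by simp [hij]⟩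
    · exact Or.inr ⟨0, by simp [hij]⟩

/-- The substituted generic matrix is the block matrix `(X 0; 0 I)` up to the index splitting.
[cite: KumarRamyaSaptharishiTengse2022, §3.4] -/
theorem of_padSubst_eq (h : m ≤ m') :
    (Matrix.of fun i j : Fin m' => padSubst k h (i, j)) =
      (Matrix.fromBlocks (mvPolynomialX (Fin m) (Fin m) k) 0 0 1).submatrix
        (split h).symm (split h).symm := by
  ext i j
  simp only [Matrix.of_apply, Matrix.submatrix_apply, padSubst]
  rcases (split h).symm i with a | a <;> rcases (split h).symm j with b | b
  · simp [Matrix.fromBlocks_apply₁₁, mvPolynomialX_apply]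
  · simp [Matrix.fromBlocks_apply₁₂]
  · simp [Matrix.fromBlocks_apply₂₁]
  · by_cases hab : a = b
    · subst hab; simp [Matrix.fromBlocks_apply₂₂]
    · simp [Matrix.fromBlocks_apply₂₂, hab, Matrix.one_apply_ne hab]

/-- **The block identity** `per_{m'}(X 0; 0 I) = per_m(X)`: substituting the padding into the
generic `m' × m'` permanent gives the generic `m × m` permanent. [cite: KumarRamyaSaptharishiTengse2022, §3.4] -/
theorem aeval_padSubst_perPoly (h : m ≤ m') :
    aeval (padSubst k h) (perPoly (Fin m') k) = perPoly (Fin m) k := by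
  have h1 : aeval (padSubst k h) (perPoly (Fin m') k) =
      (Matrix.of fun i j : Fin m' => padSubst k h (i, j)).permanent := by
    unfold perPoly
    rw [← AlgHom.coe_toRingHom, ← permanent_map_ringHom']
    congr 1
    ext i j
    simp [Matrix.map_apply, mvPolynomialX_apply]
  rw [h1, of_padSubst_eq, permanent_submatrix_equiv, permanent_fromBlocks_zero₂₁,
    Matrix.permanent_one, mul_one]
  rfl

/-- **`per_m` is a projection of `per_{m'}`** for `m ≤ m'`. [cite: Burgisser2000, Def. 2.6] -/
theorem isProjection_perPoly_of_le (h : m ≤ m') : IsProjection (perPoly (Fin m) k) (perPoly (Fin m') k) :=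
  ⟨padSubst k h, padSubst_isVarOrConst k h, (aeval_padSubst_perPoly k h).symm⟩

/-- **Monotonicity of the complexity of the permanent**: `L(per_m) ≤ L(per_{m'})` for `m ≤ m'`
(projections are free). [cite: KumarRamyaSaptharishiTengse2022, §3.5] -/
theorem complexity_perPoly_mono (h : m ≤ m') :
    complexity (perPoly (Fin m) k) ≤ complexity (perPoly (Fin m') k) :=
  complexity_le_of_isProjection (isProjection_perPoly_of_le k h)

end Pad

/-- **Hardness transfers upward** (referee B13, cell `valiant-natproofs`): hardness of the
permanent along a subsequence — e.g. `2^j ≤ L(per_{j^c})` for `j ≥ j₀`, the ℕ-form of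
"`Perm_m` requires size `2^{m^ε}`" with `ε = 1/c` — gives hardness at every size `M ≥ j^c`:
`2^j ≤ L(per_M)`. [cite: KumarRamyaSaptharishiTengse2022, §3.5] -/
theorem two_pow_le_complexity_perPoly_of_le (k : Type*) [CommSemiring k] {s j M : ℕ}
    (hj : 2 ^ j ≤ complexity (perPoly (Fin s) k)) (hM : s ≤ M) :
    2 ^ j ≤ complexity (perPoly (Fin M) k) :=
  hj.trans (complexity_perPoly_mono k hM)

end Literature.Computability.AlgebraicComplexity

end
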